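import Mathlib
import Summits.ValiantsHypothesis.ValiantsHypothesis.Theorems.MonotoneRestorationOrbitRestorationQPLinearSubalgebra
import Summits.ValiantsHypothesis.ValiantsHypothesis.Theorems.MonotoneRestorationOrbitRestorationQPRankDistance
import HarnessLib

/-!
# The linear / non-linear factor split of a polynomial (ORBIT currency)

Route MonotoneRestoration, crux `OrbitRestorationQP` (stmt-ValiantsHypothesis-18293), line `depth-three-rung`, registered stub
`stub_sigmaPiSigmaKValue` (A_k).  Namespace `Summit.ValiantsHypothesis.ValiantsHypothesis.Theorems.LinNL`.  Route-independent.

Layer L4 (b) of the formalisation plan of `Cruxes/OrbitRestorationQP/Lines/depth-three-rung-stubA-bounded-fanin.md` (§2 (c)–(f),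
§8 L4: "Lin/NL split").  Over a field, `K[V]` is factorial (Mathlib); for `F ≠ 0` let `linPart F` be the multiset of the irreducible
factors of total degree `1` (a multiset of affine forms) and `nlPart F` the product of the other irreducible factors.  Proved here:

* `exists_eq_C_mul` — `F = C u · Π (linPart F) · nlPart F` with `u ≠ 0`; `card_linPart_le` — `|linPart F| ≤ deg F`;
* `prod_associated_of_rel`, `filter_rel` — bookkeeping for `Multiset.Rel Associated`;
* `nlPart_map` — `nlPart (φ F) ~ᵤ φ (nlPart F)` for an algebra automorphism preserving total degrees (equivariance);
  `linPart_map` — the same for the linear part (as products);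
* `nlPart_affine_mul` — `nlPart (Π G · P) ~ᵤ nlPart P` when `G` consists of affine forms;
* `nlPart_mem_adjoin` — **if `P ∈ K[Λ]` (`Λ` affine forms with constants) then `nlPart P ∈ K[Λ]`** (linear-divisor and quotient
  closedness of `…LinearSubalgebra.lean`).

Everything is proved. [folklore]
-/

noncomputable section

open MvPolynomial UniqueFactorizationMonoid

-- `Summit.ValiantsHypothesis.ValiantsHypothesis.…` is the tree's single-conjunct layout (Sub = Summit).
set_option linter.dupNamespace false

namespace Summit.ValiantsHypothesis.ValiantsHypothesis.Theorems

namespace LinNL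

open LinearSubalgebra RankDistance

variable {K : Type} [Field K] {V : Type}

/-! ### Bookkeeping for `Multiset.Rel Associated` -/

/-- Related multisets have associated products. [folklore] -/
theorem prod_associated_of_rel {s t : Multiset (MvPolynomial V K)} (h : Multiset.Rel Associated s t) :
    Associated s.prod t.prod := by
  rw [← Associates.mk_eq_mk_iff_associated, ← Associates.prod_mk, ← Associates.prod_mk,
    Associates.rel_associated_iff_map_eq_map.1 h]

/-- Filtering related multisets by a predicate constant on associate classes. [folklore] -/
theorem filter_rel {s t : Multiset (MvPolynomial V K)} (h : Multiset.Rel Associated s t) (P : MvPolynomial V K → Prop)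
    [DecidablePred P] (hP : ∀ a b : MvPolynomial V K, Associated a b → (P a ↔ P b)) :
    Multiset.Rel Associated (s.filter P) (t.filter P) := by
  classical
  let P' : Associates (MvPolynomial V K) → Prop := fun a => P (Quot.out a)
  have hP' : ∀ q : MvPolynomial V K, P' (Associates.mk q) ↔ P q := fun q => hP _ _ (Associates.mk_quot_out q)
  have key : ∀ u : Multiset (MvPolynomial V K), (u.filter P).map Associates.mk = (u.map Associates.mk).filter P' := by
    intro u
    rw [Multiset.filter_map]
    congr 1
    exact Multiset.filter_congr fun q _ => (hP' q).symm
  rw [Associates.rel_associated_iff_map_eq_map, key, key, Associates.rel_associated_iff_map_eq_map.1 h]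

/-- Associated polynomials have the same total degree (units are nonzero constants). [folklore] -/
theorem totalDegree_eq_of_associated {a b : MvPolynomial V K} (h : Associated a b) : a.totalDegree = b.totalDegree := by
  rw [← totalDegree_nrm a, ← totalDegree_nrm b, nrm_eq_of_associated h]

/-! ### The split -/

/-- The multiset of the irreducible factors of total degree `1` (affine forms). [folklore] -/
def linPart (F : MvPolynomial V K) : Multiset (MvPolynomial V K) := (factors F).filter fun q => q.totalDegree = 1

/-- The product of the irreducible factors of total degree `≠ 1`. [folklore] -/
def nlPart (F : MvPolynomial V K) : MvPolynomial V K := ((factors F).filter fun q => ¬ q.totalDegree = 1).prod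

/-- Members of `linPart F` have total degree `1`. [folklore] -/
theorem totalDegree_of_mem_linPart {F q : MvPolynomial V K} (hq : q ∈ linPart F) : q.totalDegree = 1 :=
  (Multiset.mem_filter.1 hq).2

/-- `Π (linPart F) · nlPart F ~ᵤ F`. [folklore] -/
theorem associated_split {F : MvPolynomial V K} (hF : F ≠ 0) : Associated ((linPart F).prod * nlPart F) F := by
  rw [linPart, nlPart, ← Multiset.prod_add, Multiset.filter_add_not]
  exact factors_prod hF

/-- **The split**: `F = C u · Π (linPart F) · nlPart F` with `u ≠ 0`. [folklore] -/
theorem exists_eq_C_mul {F : MvPolynomial V K} (hF : F ≠ 0) :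
    ∃ u : K, u ≠ 0 ∧ F = C u * ((linPart F).prod * nlPart F) := by
  obtain ⟨w, hw⟩ := associated_split hF
  obtain ⟨u, hu, hwu⟩ := MvPolynomial.isUnit_iff_eq_C_of_isReduced.1 w.isUnit
  refine ⟨u, hu.ne_zero, ?_⟩
  calc F = (linPart F).prod * nlPart F * ↑w := hw.symm
    _ = C u * ((linPart F).prod * nlPart F) := by rw [hwu, mul_comm]

/-- `nlPart F ≠ 0` for `F ≠ 0`. [folklore] -/
theorem nlPart_ne_zero {F : MvPolynomial V K} (hF : F ≠ 0) : nlPart F ≠ 0 := by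
  intro h
  have := associated_split hF
  rw [h, mul_zero] at this
  exact hF (associated_zero_iff_eq_zero _ |>.1 this.symm)

/-- An irreducible polynomial over a field has total degree `≥ 1`. [folklore] -/
theorem one_le_totalDegree_of_irreducible {q : MvPolynomial V K} (hq : Irreducible q) : 1 ≤ q.totalDegree := by
  by_contra h
  have h0 : q.totalDegree = 0 := by omega
  obtain ⟨c, hc⟩ : ∃ c, q = C c := ⟨_, (totalDegree_eq_zero_iff_eq_C).1 h0⟩
  have hc0 : c ≠ 0 := by rintro rfl; rw [C_0] at hc; exact hq.ne_zero hc
  exact hq.not_isUnit (hc ▸ (isUnit_iff_ne_zero.2 hc0).map C)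

/-- The total degree of a product of nonzero polynomials over a field is the sum of the total degrees. [folklore] -/
theorem totalDegree_multiset_prod {s : Multiset (MvPolynomial V K)} (h : ∀ q ∈ s, q ≠ 0) :
    s.prod.totalDegree = (s.map totalDegree).sum := by
  induction s using Multiset.induction_on with
  | empty => simp
  | cons a s ih =>
    have ha : a ≠ 0 := h a (Multiset.mem_cons_self a s)
    have hs : ∀ q ∈ s, q ≠ 0 := fun q hq => h q (Multiset.mem_cons_of_mem hq)
    have hs0 : s.prod ≠ 0 := Multiset.prod_ne_zero fun h0 => hs 0 h0 rfl
    rw [Multiset.prod_cons, Multiset.map_cons, Multiset.sum_cons, totalDegree_mul_of_isDomain ha hs0, ih hs]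

/-- **`|linPart F| ≤ deg F`.** [folklore] -/
theorem card_linPart_le {F : MvPolynomial V K} (hF : F ≠ 0) : Multiset.card (linPart F) ≤ F.totalDegree := by
  have hne : ∀ q ∈ factors F, q ≠ 0 := fun q hq => (irreducible_of_factor q hq).ne_zero
  have hdeg : F.totalDegree = ((factors F).map totalDegree).sum := by
    rw [← totalDegree_eq_of_associated (factors_prod hF), totalDegree_multiset_prod hne]
  rw [hdeg]
  calc Multiset.card (linPart F) ≤ Multiset.card (factors F) := Multiset.card_le_card (Multiset.filter_le _ _)
    _ = ((factors F).map fun _ => 1).sum := by simp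
    _ ≤ ((factors F).map totalDegree).sum :=
        Multiset.sum_map_le_sum_map _ _ fun q hq => one_le_totalDegree_of_irreducible (irreducible_of_factor q hq)

/-- `nlPart F` divides `F`. [folklore] -/
theorem nlPart_dvd {F : MvPolynomial V K} (hF : F ≠ 0) : nlPart F ∣ F :=
  (Dvd.intro_left _ rfl : nlPart F ∣ (linPart F).prod * nlPart F) |>.trans (associated_split hF).dvd

/-! ### Equivariance -/

/-- The factors of `φ F` are the images of the factors of `F`, up to association. [folklore] -/
theorem rel_factors_map (φ : MvPolynomial V K ≃ₐ[K] MvPolynomial V K) {F : MvPolynomial V K} (hF : F ≠ 0) :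
    Multiset.Rel Associated (factors (φ F)) ((factors F).map φ) := by
  refine factors_unique irreducible_of_factor (fun x hx => ?_) ?_
  · obtain ⟨q, hq, rfl⟩ := Multiset.mem_map.1 hx
    exact (MulEquiv.irreducible_iff (φ : MvPolynomial V K ≃* MvPolynomial V K)).2 (irreducible_of_factor q hq)
  · rw [← map_multiset_prod]
    exact (factors_prod ((map_ne_zero_iff φ φ.injective).2 hF)).trans ((factors_prod hF).map φ).symm

/-- **Equivariance of the non-linear part** under an algebra automorphism preserving total degrees. [folklore] -/
theorem nlPart_map (φ : MvPolynomial V K ≃ₐ[K] MvPolynomial V K) (hφ : ∀ q : MvPolynomial V K, (φ q).totalDegree = q.totalDegree)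
    {F : MvPolynomial V K} (hF : F ≠ 0) : Associated (nlPart (φ F)) (φ (nlPart F)) := by
  classical
  have h1 := filter_rel (rel_factors_map φ hF) (fun q => ¬ q.totalDegree = 1)
    (fun a b hab => by rw [totalDegree_eq_of_associated hab])
  rw [Multiset.filter_map] at h1
  have h2 : (Multiset.filter ((fun q : MvPolynomial V K => ¬ q.totalDegree = 1) ∘ φ) (factors F)) =
      (factors F).filter fun q => ¬ q.totalDegree = 1 := Multiset.filter_congr fun q _ => by simp [hφ]
  rw [h2] at h1
  refine (prod_associated_of_rel h1).trans ?_
  rw [nlPart, ← map_multiset_prod]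

/-- **Equivariance of the linear part** (as products) under an algebra automorphism preserving total degrees. [folklore] -/
theorem linPart_map (φ : MvPolynomial V K ≃ₐ[K] MvPolynomial V K) (hφ : ∀ q : MvPolynomial V K, (φ q).totalDegree = q.totalDegree)
    {F : MvPolynomial V K} (hF : F ≠ 0) : Multiset.Rel Associated (linPart (φ F)) ((linPart F).map φ) := by
  classical
  have h1 := filter_rel (rel_factors_map φ hF) (fun q => q.totalDegree = 1)
    (fun a b hab => by rw [totalDegree_eq_of_associated hab])
  rw [Multiset.filter_map] at h1
  have h2 : (Multiset.filter ((fun q : MvPolynomial V K => q.totalDegree = 1) ∘ φ) (factors F)) =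
      (factors F).filter fun q => q.totalDegree = 1 := Multiset.filter_congr fun q _ => by simp [hφ]
  rw [h2] at h1
  exact h1

/-! ### Affine factors do not touch the non-linear part -/

/-- The factors of a product of affine forms are the forms. [folklore] -/
theorem rel_factors_affine_prod {G : Multiset (MvPolynomial V K)} (hG : ∀ q ∈ G, q.totalDegree = 1) :
    Multiset.Rel Associated (factors G.prod) G := by
  have hirr : ∀ q ∈ G, Irreducible q := fun q hq =>
    (UniqueFactorizationMonoid.irreducible_iff_prime).2
      (by
        have := hG q hq
        refine UniqueFactorizationMonoid.irreducible_iff_prime.1 (MvPolynomial.irreducible_of_totalDegree_eq_one this ?_)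
        intro x hx
        by_cases hx0 : x = 0
        · subst hx0
          have hq0 : q = 0 := MvPolynomial.ext _ _ fun i => by simpa using hx i
          rw [hq0, totalDegree_zero] at this
          exact absurd this zero_ne_one
        · exact isUnit_iff_ne_zero.2 hx0)
  have h0 : G.prod ≠ 0 := Multiset.prod_ne_zero fun h => by
    have := hG 0 h; rw [totalDegree_zero] at this; exact zero_ne_one this
  exact factors_unique irreducible_of_factor hirr (factors_prod h0)

/-- **`nlPart (Π G · P) ~ᵤ nlPart P`** when `G` consists of affine forms. [folklore] -/
theorem nlPart_affine_mul {G : Multiset (MvPolynomial V K)} (hG : ∀ q ∈ G, q.totalDegree = 1) {P : MvPolynomial V K}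
    (hP : P ≠ 0) : Associated (nlPart (G.prod * P)) (nlPart P) := by
  classical
  have hG0 : G.prod ≠ 0 := Multiset.prod_ne_zero fun h => by
    have := hG 0 h; rw [totalDegree_zero] at this; exact zero_ne_one this
  have h1 : Multiset.Rel Associated (factors (G.prod * P)) (G + factors P) :=
    (factors_mul hG0 hP).trans _ ((rel_factors_affine_prod hG).add (Multiset.rel_refl_of_refl_on fun _ _ => Associated.refl _))
  have h2 := filter_rel h1 (fun q => ¬ q.totalDegree = 1) (fun a b hab => by rw [totalDegree_eq_of_associated hab])
  have hG' : Multiset.filter (fun q : MvPolynomial V K => ¬ q.totalDegree = 1) G = 0 :=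
    Multiset.filter_eq_nil.2 fun q hq => by simp [hG q hq]
  rw [Multiset.filter_add, hG', zero_add] at h2
  exact prod_associated_of_rel h2

/-! ### The non-linear part stays in the subalgebra -/

/-- **If `P ∈ K[Λ]` then `nlPart P ∈ K[Λ]`** (`Λ` affine forms containing the constants, finitely many variables): every linear
factor of `P` lies in `Λ`, and the quotient of `P` by their product stays in `K[Λ]`. [folklore] -/
theorem nlPart_mem_adjoin [Fintype V] [DecidableEq V] {Λ : Submodule K (MvPolynomial V K)} (hΛ : Λ ≤ deg1 K V) (h1 : C 1 ∈ Λ)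
    {P : MvPolynomial V K} (hP : P ∈ Algebra.adjoin K (Λ : Set (MvPolynomial V K))) (hP0 : P ≠ 0) :
    nlPart P ∈ Algebra.adjoin K (Λ : Set (MvPolynomial V K)) := by
  obtain ⟨u, hu, hPe⟩ := exists_eq_C_mul hP0
  -- the linear factors are in `Λ`
  have hlin : ∀ q ∈ linPart P, q ∈ Λ := fun q hq =>
    mem_of_dvd_of_totalDegree_le_one hΛ h1 hP hP0 (totalDegree_of_mem_linPart hq).le
      ((Multiset.dvd_prod hq).trans ((Dvd.intro _ rfl : (linPart P).prod ∣ (linPart P).prod * nlPart P).trans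
        (associated_split hP0).dvd))
  have hprod : C u * (linPart P).prod ∈ Algebra.adjoin K (Λ : Set (MvPolynomial V K)) :=
    Subalgebra.mul_mem _ (Subalgebra.algebraMap_mem _ u)
      (Subalgebra.multiset_prod_mem _ fun q hq => Algebra.subset_adjoin (hlin q hq))
  have hne : C u * (linPart P).prod ≠ 0 := by
    refine mul_ne_zero ((map_ne_zero_iff C (C_injective V K)).2 hu) (Multiset.prod_ne_zero fun h => ?_)
    have := totalDegree_of_mem_linPart h
    rw [totalDegree_zero] at this
    exact zero_ne_one this
  refine mem_adjoin_of_mul_mem hΛ h1 hprod hne ?_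
  rw [mul_assoc, ← hPe]
  exact hP

end LinNL

end Summit.ValiantsHypothesis.ValiantsHypothesis.Theorems

end
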